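import Summits.BirchSwinnertonDyer.BirchSwinnertonDyer.Theorems.SylvesterTwoHeegnerIndexUpperOffV0DescentTwoOfLeaves
import Summits.BirchSwinnertonDyer.BirchSwinnertonDyer.Theorems.SylvesterTwoHeegnerIndexUpperOffV0DualityTwo
import Literature.NumberTheory.EllipticCurves.HeegnerPointsKolyvaginPrimaryAtPrimeProofs
import HarnessLib

/-!
# K7t crux `UpperOffV0HSY` (item 19581): Kolyvagin at `p = 2` for `y² = x³ − c`, WITH THE DEFECT —
# `Ш(E/K)[2^∞]` finite and killed by `2^{2M₀+4}` from the stubs (d), (e)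

Route `SylvesterTwoHeegnerIndex` (cell bsd-cm, rung K7t), line `offv0-kolyvagin2` on
stmt-BirchSwinnertonDyer-19581.  The tree's per-prime Kolyvagin theorem
`KolyvaginDescent.sha_primary_finite_at_of_pointsM_of_reciprocityM`
(`Literature/…/HeegnerPointsKolyvaginPrimaryAtPrimeProofs`: `Ш(E/K)[p^∞]` finite from Heegner-type
points `hpoints` and Kolyvagin reciprocity `hR` at an ODD prime `p` with `ρ̄_{E,p}` onto) has the
binders `hpoints` / `hR` of EXACTLY the shape of the registered stubs (d) `stub_kolyvaginClasses_two` /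
(e) `stub_kolyvaginReciprocity_two` of the line (there with `p := 2`).  This file is its `p = 2` twin
for a `ℚ`-model `W` of `y² = x³ − c` over an imaginary quadratic `K` with `∛c ∉ K`, `ω ∉ K` and
`E(K)[2] = 0`, assembled from this seat's chain: leaf (A) from the points (the tree's p-generic
`exists_leafA_of_points`), leaf (B) WITH DEFECT ONE from (R)_M (`hdual_two_of_kolyvaginReciprocityM`
below, around `lemma_5_3_descent_of_reciprocity_two`, p467003), the descent from the leaves
(`descentTwo_of_leaves`, = the parity-free count `descent_defect'` p462120 with its Čebotarev inputs
discharged, p449935/p467040), and the passage to `Ш` (Silverman X.4.2 in the tree):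

* `hdual_two_of_kolyvaginReciprocityM` — (R)_M at the Kolyvagin primes of level `M` at `2` ⟹ the
  descent-form duality with defect one (`2^a d_λ ≠ 0 ⟹ 2^{M-1-a+1} s_λ = 0`);
* `sha_two_primary_exponent_of_pointsM_of_reciprocityM` — **Kolyvagin's theorem at `p = 2` for these
  CM curves, exponent form with the defect made explicit: `Ш(E/K)[2^∞]` is finite and killed by
  `2^{2M₀+4}`**, where `2^{M₀}` is the exact power of `2` dividing `y_K` in `E(K)` (McCallum's
  Lemma 5.1), GRANTED (d) and (e) for this curve and `E(K)[2] = 0`.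

HONEST FRAMING.  This is what the 2-adic Heegner-point Euler system gives by the generic method:
exponent `2M₀ + 4`, not the crux's ORDER bound `ord₂ #Ш(E/K)[2^∞] ≤ 2M₀` (`UpperOffV0HSY` in pair
currency).  The four extra powers of `2` (duality `+1` twice, socle configuration `+1`,
eigen-decomposition `+1`) and the exponent-versus-order gap are the typed residue of the crux; B14 =
O12 stays open as a class.  No named fact, no definition; (d), (e), `E(K)[2] = 0` are displayed
hypotheses.
-/

noncomputable section

open scoped Classical
open WeierstrassCurve NumberField IsDedekindDomain Field Literature.NumberTheory.EllipticCurves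
  Literature.NumberTheory.GaloisRepresentations Literature.NumberTheory.EllipticCurves.KolyvaginDescent

set_option autoImplicit false
set_option linter.dupNamespace false

namespace Summit.BirchSwinnertonDyer.BirchSwinnertonDyer.Theorems.SylvesterTwoUpper

universe u

variable {N : ℕ} [NeZero N] (W : WeierstrassCurve ℚ) {K : Type u} [Field K] [NumberField K]

/-- **Leaf (B) at `p = 2` with defect one, from Kolyvagin reciprocity (R)_M** (the `p = 2` twin of
the tree's `hdual_of_kolyvaginReciprocityM`): for a Heegner point `P` of level `N` (good reduction at
the Kolyvagin primes), `M ≥ 1`, and (R)_M at every Kolyvagin prime of level `M` at `2` — the shape of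
stub (e) — the descent-form duality `2^a d_λ ≠ 0 ⟹ 2^{M-1-a+1} s_λ = 0` for same-sign eigenclasses,
by `lemma_5_3_descent_of_reciprocity_two`. [cite: McCallumLMS1991, §5 Lemma 5.3, §2 Prop. 2.2] -/
theorem hdual_two_of_kolyvaginReciprocityM [W.IsElliptic] (hK : IsImaginaryQuadratic K)
    {C : VariableChange ℚ} {cM : ℚ} (hCW : C • W = ⟨0, 0, 0, 0, -cM⟩)
    {P : (W.baseChange K).toAffine.Point} (hP : IsHeegnerPoint N W K P) {M : ℕ} (hM : 1 ≤ M)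
    {c : K ≃ₐ[ℚ] K} (hc : c ≠ 1)
    (hR : ∀ {ℓ : ℕ} (hℓ : IsKolyvaginPrime N W K 2 ℓ), FrobEqFrobInfty W K (2 ^ M) ℓ →
      ∃ (A : Type u) (_ : AddCommGroup A)
        (e : geomTorsion (W.baseChange K) ((2 ^ M : ℕ) : ℤ) →+
          geomTorsion (W.baseChange K) ((2 ^ M : ℕ) : ℤ) →+ A),
        (∀ x, e x x = 0) ∧ (∀ x, (∀ y, e x y = 0) → x = 0) ∧
        ∀ s ∈ selmerGroup (W.baseChange K) ((2 ^ M : ℕ) : ℤ),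
          ∀ c' : galH1Torsion (W.baseChange K) ((2 ^ M : ℕ) : ℤ),
          (∀ v : HeightOneSpectrum (𝓞 K), (ℓ : 𝓞 K) ∉ v.asIdeal →
            c' ∈ selmerLocalKer (W.baseChange K) (v.adicCompletion K) ((2 ^ M : ℕ) : ℤ)) →
          (∀ w : InfinitePlace K,
            c' ∈ selmerLocalKer (W.baseChange K) w.Completion ((2 ^ M : ℕ) : ℤ)) →
          ∀ 𝔔 ∈ hℓ.place.primesAbove, ∀ F : absoluteGaloisGroup K, IsArithFrobAt (𝓞 K) F 𝔔 →
            F ∈ torsionFixing (W.baseChange K) ((2 ^ M : ℕ) : ℤ) →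
            ∀ σ ∈ 𝔔.inertia (absoluteGaloisGroup K),
            e (h1Eval (W.baseChange K) ((2 ^ M : ℕ) : ℤ) s F)
              (h1Eval (W.baseChange K) ((2 ^ M : ℕ) : ℤ) c' σ) = 0) :
    ∀ ℓ : ℕ, IsKolyvaginPrime N W K 2 ℓ ∧ FrobEqFrobInfty W K (2 ^ M) ℓ →
      ∀ ν : ℤ, (ν = 1 ∨ ν = -1) → ∀ d : galH1Torsion (W.baseChange K) ((2 ^ M : ℕ) : ℤ),
      conjAct W c _ d = ν • d →
      (∀ v : HeightOneSpectrum (𝓞 K), (ℓ : 𝓞 K) ∉ v.asIdeal →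
        d ∈ selmerLocalKer (W.baseChange K) (v.adicCompletion K) ((2 ^ M : ℕ) : ℤ)) →
      (∀ w : InfinitePlace K,
        d ∈ selmerLocalKer (W.baseChange K) w.Completion ((2 ^ M : ℕ) : ℤ)) →
      ∀ s ∈ selmerGroup (W.baseChange K) ((2 ^ M : ℕ) : ℤ), conjAct W c _ s = ν • s →
      ∀ a : ℕ, a < M → ∀ v : HeightOneSpectrum (𝓞 K), (ℓ : 𝓞 K) ∈ v.asIdeal →
        (((2 : ℕ) : ℤ) ^ a) • d ∉
          selmerLocalKer (W.baseChange K) (v.adicCompletion K) ((2 ^ M : ℕ) : ℤ) →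
        (((2 : ℕ) : ℤ) ^ (M - 1 - a + 1)) • s ∈
          (W.baseChange K).torsionLocalKer (v.adicCompletion K) ((2 ^ M : ℕ) : ℤ) := by
  intro ℓ hℓ ν hν d hd hfin hinf s hs hτs a ha v hv hdv
  have hvw : v = hℓ.1.place := hℓ.1.mem_iff.mp hv
  subst hvw
  have hgood : (W.baseChange K).HasGoodReductionAt hℓ.1.place := by
    have h := IsKolyvaginPrime.not_mem_badPlaces (W := W) hP hℓ.1
    rwa [WeierstrassCurve.mem_badPlaces_iff, not_not] at h
  obtain ⟨A, _, e, halt, hnd, hRe⟩ := hR hℓ.1 hℓ.2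
  rw [show M - 1 - a + 1 = M - a by omega]
  exact lemma_5_3_descent_of_reciprocity_two W hK hCW hc hℓ.1 hM rfl hℓ.2 hgood e halt hnd hν hd
    hdv hs hτs (fun 𝔔 h𝔔 F hF hFT σ hσ ↦ hRe s hs d hfin hinf 𝔔 h𝔔 F hF hFT σ hσ)

/-- **Kolyvagin's theorem at `p = 2` for `y² = x³ − c`, exponent form, with the defect explicit:
`Ш(E/K)[2^∞]` is finite and killed by `2^{2M₀+4}`**, for a `ℚ`-model `W` of `y² = x³ − c` over an
imaginary quadratic `K` with `∛c ∉ K`, `ω ∉ K`, `E(K)[2] = 0`, and a Heegner point `P = y_K` of level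
`N` of infinite order, GRANTED — at every level `2^M`, `M ≥ 1`, and for the complex conjugation `c` —
Heegner-type points with their signs and local properties (`hpoints`, the shape of stub (d)) and
Kolyvagin reciprocity (R)_M (`hR`, the shape of stub (e)).  Here `2^{M₀}` is the exact power of `2`
dividing `P` in `E(K)` (`2^{M₀} x₀ = P`, no `Q` with `2^{M₀+1} Q = P`: McCallum Lemma 5.1, the tree's
`exists_kummer_generator_pow`).  Chain: `exists_leafA_of_points` → `hdual_two_of_kolyvaginReciprocityM`
→ `descentTwo_of_leaves` (`2·2^{2M₀+3} S_{2^j}(E/K) ⊆ ℤ δ_j x₀`, every `j ≥ 1`) → Silverman X.4.2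
(`map_torsionH1ToH1_selmerGroup_holds`, `torsionH1ToH1_kummerMapTorsion`,
`finite_sha_primary_of_pow_smul_eq_zero`).  The odd-`p` original (`sha_primary_finite_at_of_pointsM…`)
gives exponent `2M₀`; the `+4` is the 2-adic defect (duality twice, socle, decomposition).
[cite: McCallumLMS1991, §1 Theorem (Kolyvagin), §§3–5] [cite: GrossLMS1991, Thm. 1.3 (2), §10]
[cite: SilvermanAEC2009, Thm X.4.2] -/
theorem sha_two_primary_exponent_of_pointsM_of_reciprocityM [W.IsElliptic]
    (hK : IsImaginaryQuadratic K)
    {C : VariableChange ℚ} {cM : ℚ} (hCW : C • W = ⟨0, 0, 0, 0, -cM⟩)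
    (hcube : ∀ x : K, x ^ 3 ≠ (cM : K)) (hωK : ∀ x : K, x ^ 2 + x + 1 ≠ 0)
    (hA2 : ∀ a : (W.baseChange K).toAffine.Point, 2 • a = 0 → a = 0)
    {P : (W.baseChange K).toAffine.Point} (hP : IsHeegnerPoint N W K P) (hnt : ¬ IsOfFinAddOrder P)
    (hpoints : ∀ {M : ℕ} (_hM : 1 ≤ M)
      (hdiv : ∀ Q : geomPoints (W.baseChange K), ∃ R, ((2 ^ M : ℕ) : ℤ) • R = Q)
      (c : K ≃ₐ[ℚ] K) (_hc : c ≠ 1),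
      ∃ (ε : ℤ) (τ : AlgebraicClosure K ≃+* AlgebraicClosure K) (hτ : IsLiftOfAut c τ)
        (A : ℕ → AddSubgroup (geomPoints (W.baseChange K)))
        (hA : ∀ m, KolyvaginCocycle.IsAdmissible (Field.absoluteGaloisGroup K) (A m)
          ((2 ^ M : ℕ) : ℤ))
        (Pt : ℕ → geomPoints (W.baseChange K))
        (hPt : ∀ m, Pt m ∈
          KolyvaginCocycle.invPoints (Field.absoluteGaloisGroup K) (A m) ((2 ^ M : ℕ) : ℤ)),
        (ε = 1 ∨ ε = -1) ∧
        IsOfFinAddOrder (Affine.Point.map (W' := W) (c : K →ₐ[ℚ] K) P - ε • P) ∧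
        (∀ m, ∀ a ∈ A m, hτ.pointsMap W a ∈ A m) ∧
        Pt 1 = toGeomPoints (W.baseChange K) P ∧
        (∀ m : ℕ, Squarefree m →
          (∀ q ∈ m.primeFactors, IsKolyvaginPrime N W K 2 q ∧ FrobEqFrobInfty W K (2 ^ M) q) →
          (∃ B ∈ A m, hτ.pointsMap W (Pt m) =
            (ε * (-1) ^ m.primeFactors.card) • Pt m + ((2 ^ M : ℕ) : ℤ) • B) ∧
          (∀ v : HeightOneSpectrum (𝓞 K), (m : 𝓞 K) ∉ v.asIdeal →
            kolyvaginClass (W.baseChange K) _ hdiv (hA m) (Pt m) (hPt m) ∈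
              selmerLocalKer (W.baseChange K) (v.adicCompletion K) ((2 ^ M : ℕ) : ℤ)) ∧
          (∀ ℓ : ℕ, ℓ.Prime → ℓ ∣ m → ∀ v : HeightOneSpectrum (𝓞 K), (ℓ : 𝓞 K) ∈ v.asIdeal →
            ∀ a : ℕ, ((((2 : ℕ) : ℤ) ^ a) •
                kolyvaginClass (W.baseChange K) _ hdiv (hA m) (Pt m) (hPt m) ∈
                selmerLocalKer (W.baseChange K) (v.adicCompletion K) ((2 ^ M : ℕ) : ℤ) ↔
              (((2 : ℕ) : ℤ) ^ a) • kolyvaginClass (W.baseChange K) _ hdiv (hA (m / ℓ)) (Pt (m / ℓ))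
                  (hPt (m / ℓ)) ∈
                (W.baseChange K).torsionLocalKer (v.adicCompletion K) ((2 ^ M : ℕ) : ℤ)))))
    (hR : ∀ {M : ℕ} (_hM : 1 ≤ M) {ℓ : ℕ} (hℓ : IsKolyvaginPrime N W K 2 ℓ),
      FrobEqFrobInfty W K (2 ^ M) ℓ →
      ∃ (A : Type u) (_ : AddCommGroup A)
        (e : geomTorsion (W.baseChange K) ((2 ^ M : ℕ) : ℤ) →+
          geomTorsion (W.baseChange K) ((2 ^ M : ℕ) : ℤ) →+ A),
        (∀ x, e x x = 0) ∧ (∀ x, (∀ y, e x y = 0) → x = 0) ∧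
        ∀ s ∈ selmerGroup (W.baseChange K) ((2 ^ M : ℕ) : ℤ),
          ∀ c' : galH1Torsion (W.baseChange K) ((2 ^ M : ℕ) : ℤ),
          (∀ v : HeightOneSpectrum (𝓞 K), (ℓ : 𝓞 K) ∉ v.asIdeal →
            c' ∈ selmerLocalKer (W.baseChange K) (v.adicCompletion K) ((2 ^ M : ℕ) : ℤ)) →
          (∀ w : InfinitePlace K,
            c' ∈ selmerLocalKer (W.baseChange K) w.Completion ((2 ^ M : ℕ) : ℤ)) →
          ∀ 𝔔 ∈ hℓ.place.primesAbove, ∀ F : Field.absoluteGaloisGroup K,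
            IsArithFrobAt (𝓞 K) F 𝔔 →
            F ∈ torsionFixing (W.baseChange K) ((2 ^ M : ℕ) : ℤ) →
            ∀ σ ∈ 𝔔.inertia (Field.absoluteGaloisGroup K),
            e (h1Eval (W.baseChange K) ((2 ^ M : ℕ) : ℤ) s F)
              (h1Eval (W.baseChange K) ((2 ^ M : ℕ) : ℤ) c' σ) = 0) :
    ∃ (M₀ : ℕ) (x₀ : (W.baseChange K).toAffine.Point),
      2 ^ M₀ • x₀ = P ∧ (∀ Q : (W.baseChange K).toAffine.Point, 2 ^ (M₀ + 1) • Q ≠ P) ∧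
      (∀ cs : (W.baseChange K).sha, (∃ j : ℕ, 2 ^ j • cs = 0) → 2 ^ (2 * M₀ + 4) • cs = 0) ∧
      Set.Finite {cs : (W.baseChange K).sha | ∃ j : ℕ, 2 ^ j • cs = 0} := by
  haveI : (W.baseChange K).IsElliptic := inferInstanceAs (W.map (algebraMap ℚ K)).IsElliptic
  obtain ⟨c, hc, hcc⟩ := exists_conj_of_isImaginaryQuadratic K hK
  -- `M₀`, `x₀` (McCallum Lemma 5.1, using `E(K)[2] = 0`)
  obtain ⟨M₀, x₀, hx₀, hmax, hgen⟩ :=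
    exists_kummer_generator_pow (W.baseChange K) Nat.prime_two hA2 hnt
  have hdivj : ∀ j : ℕ, ∀ Q : geomPoints (W.baseChange K), ∃ R, ((2 ^ j : ℕ) : ℤ) • R = Q :=
    fun j ↦ (W.baseChange K).zsmul_geomPoints_surjective_holds
      (by exact_mod_cast pow_ne_zero j two_ne_zero)
  -- the descent at every level `2^j`, `j ≥ 1`
  have key : ∀ j : ℕ, 1 ≤ j → ∀ s ∈ selmerGroup (W.baseChange K) ((2 ^ j : ℕ) : ℤ),
      (2 * ((2 : ℕ) : ℤ) ^ (2 * M₀ + 2 * 1 + 1)) • s ∈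
        AddSubgroup.zmultiples (kummerMapTorsion (W.baseChange K) _ (hdivj j) x₀) := by
    intro j hj s hs
    obtain ⟨ε, τ, hτ, A, hA, Pt, hPt, hε, h53, hAτ, hPt1, hm⟩ := hpoints hj (hdivj j) c hc
    obtain ⟨cl, hc1, hcl⟩ := exists_leafA_of_points (N := N) (hdivj j) c hτ ε A hA hAτ Pt hPt hPt1
      (fun m hm' hk ↦ (hm m hm' hk).1) (fun m hm' hk ↦ (hm m hm' hk).2.1)
      (fun m hm' hk ↦ (hm m hm' hk).2.2)
    obtain ⟨hPx, hxord⟩ := hgen j (by omega) (hdivj j)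
    exact descentTwo_of_leaves (N := N) hK hCW hcube hωK hj (hdivj j) hc hcc hA2 hx₀ hPx hxord ε
      hε h53 cl hc1 hcl
      (hdual_two_of_kolyvaginReciprocityM W hK hCW hP hj hc (fun hℓ hℓM ↦ hR hj hℓ hℓM)) hs
  -- passage to `Ш(E/K)[2^∞]` (Silverman X.4.2)
  have hkill : ∀ cs : (W.baseChange K).sha, (∃ j : ℕ, 2 ^ j • cs = 0) →
      2 ^ (2 * M₀ + 4) • cs = 0 := by
    rintro cs ⟨j, hj⟩
    set j' := max j 1 with hj'def
    have hj₁ : 1 ≤ j' := le_max_right _ _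
    have hj' : 2 ^ j' • cs = 0 := by
      have : j' = (j' - j) + j := by omega
      rw [this, pow_add, mul_smul, hj, smul_zero]
    have hn : ((2 ^ j' : ℕ) : ℤ) ≠ 0 := by exact_mod_cast pow_ne_zero j' two_ne_zero
    have hc' : (cs : (W.baseChange K).galH1) ∈ (W.baseChange K).sha ⊓
        AddSubgroup.torsionBy (W.baseChange K).galH1 ((2 ^ j' : ℕ) : ℤ) := by
      refine AddSubgroup.mem_inf.mpr ⟨cs.2, ?_⟩
      rw [mem_torsionBy_iff, natCast_zsmul, ← AddSubgroupClass.coe_nsmul, hj', ZeroMemClass.coe_zero]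
    rw [← (W.baseChange K).map_torsionH1ToH1_selmerGroup_holds hn, AddSubgroup.mem_map] at hc'
    obtain ⟨s, hs, hts⟩ := hc'
    have hmem := key j' hj₁ s hs
    have hker : AddSubgroup.zmultiples (kummerMapTorsion (W.baseChange K) _ (hdivj j') x₀) ≤
        (torsionH1ToH1 (W.baseChange K) ((2 ^ j' : ℕ) : ℤ)).ker :=
      AddSubgroup.zmultiples_le_of_mem (by
        rw [AddMonoidHom.mem_ker]
        exact torsionH1ToH1_kummerMapTorsion _ _ _ x₀)
    have h0 : torsionH1ToH1 (W.baseChange K) ((2 ^ j' : ℕ) : ℤ)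
        ((2 * ((2 : ℕ) : ℤ) ^ (2 * M₀ + 2 * 1 + 1)) • s) = 0 :=
      (AddMonoidHom.mem_ker).mp (hker hmem)
    rw [map_zsmul, hts] at h0
    apply Subtype.ext
    rw [AddSubgroupClass.coe_nsmul, ZeroMemClass.coe_zero, ← natCast_zsmul]
    have hcast : ((2 ^ (2 * M₀ + 4) : ℕ) : ℤ) = 2 * ((2 : ℕ) : ℤ) ^ (2 * M₀ + 2 * 1 + 1) := by
      push_cast
      ring
    rw [hcast]
    exact h0
  exact ⟨M₀, x₀, hx₀, hmax, hkill,
    (W.baseChange K).finite_sha_primary_of_pow_smul_eq_zero two_ne_zero hkill⟩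

end Summit.BirchSwinnertonDyer.BirchSwinnertonDyer.Theorems.SylvesterTwoUpper

end
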